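import Summits.AtomisticToContinuum.BoseEinsteinCondensation.Theorems.BECCutLineWeakDisorderGroundStateRigidityStubFkJensen
import Summits.AtomisticToContinuum.BoseEinsteinCondensation.Theorems.BECCutLineWeakDisorderGroundStateRigidityUniqueOfRigid
import HarnessLib

/-!
# Route `BECCutLineWeakDisorder`, crux `GroundStateRigidity` (stmt-AtomisticToContinuum-9072),
# line `Sketch`: the registered stub `stub_closedJensen`

Supports (does not close) stmt-AtomisticToContinuum-9072; stub `stub_closedJensen` of line `Sketch`
(lead c2). **Closed-form Jensen inequality against a dominated bounded potential.** For `N ≥ 1`,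
`L > 0`, measurable pair profiles `w ≤ v` with `w` bounded, and a nonnegative closed-form ground
state `Ψ₀` of `v` (`IsGroundState v L Ψ₀` of `GroundState.lean`):

`e^{-E₀(v)} ≤ ⟨Ψ₀, e^{-H(w)} Ψ₀⟩_{L²(Λ)} = ∫_Λ Ψ₀ · (e^{-H(w)} Ψ₀)`,

`E₀(v) = groundStateEnergy v N L`, `e^{-H(w)}` the Feynman–Kac semigroup at time one (`fkReal`).
This transports the landed Jensen inequality on the `C¹` Dirichlet core (`stub_fkJensen`:
`‖f‖² e^{-𝓔_w(f)/‖f‖²} ≤ ∫_Λ f · e^{-H(w)} f`) to the closed-form minimiser: near-minimising trial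
states `Φₖ → Ψ₀` in `L²` with `v`-energies `≤ E₀(v) + 1/(k+1)` (`exists_trialState_near`) have real
parts `fₖ = Re Φₖ` (real, `C¹`, Dirichlet) with `𝓔_w(fₖ) ≤ ⟨Φₖ, H(w) Φₖ⟩ ≤ ⟨Φₖ, H(v) Φₖ⟩`
(`kineticDensity_eq_realKinetic_add`, monotonicity of `interaction` in the profile) and
`‖fₖ − Ψ₀‖₂ ≤ ‖Φₖ − Ψ₀‖₂ → 0` (`Ψ₀` is real); so `‖fₖ‖² → 1`, the Jensen lower bounds tend to
`e^{-E₀(v)}`, and the pairings `∫_Λ fₖ · e^{-H(w)} fₖ = ⟪[fₖ], T[fₖ]⟫` converge to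
`⟪[Ψ₀], T[Ψ₀]⟫ = ∫_Λ Ψ₀ · e^{-H(w)} Ψ₀` by continuity of the bounded operator `T = fkL2 w L 1` on
`L²(Λ)`.

## References

* K. L. Chung, Z. Zhao, *From Brownian Motion to Schrödinger's Equation* (1995), Prop 3.29.
  [cite: ChungZhao1995, Prop 3.29]
* M. Reed, B. Simon, *Methods of Modern Mathematical Physics IV* (1978), §XIII.12.
-/

noncomputable section

open MeasureTheory Filter Set
open scoped ENNReal NNReal Topology InnerProductSpace

namespace Summit.AtomisticToContinuum.BoseEinsteinCondensation.Theorems.GroundStateRigidity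

open Literature.MathematicalPhysics.QuantumManyBody.BoseGas

namespace ClosedJensen

variable {N : ℕ}

/-! ### Energy bookkeeping for the real part of a trial state -/

/-- The interaction is monotone in the pair profile: `w ≤ v ⇒ ∑ w(|xᵢ-xⱼ|) ≤ ∑ v(|xᵢ-xⱼ|)`.
[folklore] -/
theorem interaction_mono {v w : ℝ → ℝ≥0∞} (h : ∀ r, w r ≤ v r) (X : Config N) :
    interaction w X ≤ interaction v X :=
  Finset.sum_le_sum fun _ _ => Finset.sum_le_sum fun _ _ => h _

/-- The real part of a trial state has `w`-energy at most the `v`-energy of the state (`w ≤ v`):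
`∫|∇ Re Φ|² + ∫ W (Re Φ)² ≤ ⟨Φ, H(v) Φ⟩` (`|∇ψ|² = |∇ Re ψ|² + |∇ Im ψ|²`, `|Re z| ≤ |z|`).
[folklore] -/
theorem lintegral_re_add_le_energy {v w : ℝ → ℝ≥0∞} (h : ∀ r, w r ≤ v r) {L : ℝ}
    (Φ : TrialState N L) :
    (∫⁻ X, realKinetic (fun Y => (Φ.ψ Y).re) X) +
        ∫⁻ X, interaction w X * ‖(Φ.ψ X).re‖ₑ ^ 2 ≤ energy v Φ := by
  have hu1 : ContDiff ℝ 1 (fun Y => (Φ.ψ Y).re) := Complex.reCLM.contDiff.comp Φ.contDiff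
  unfold energy
  rw [← lintegral_add_left (measurable_realKinetic hu1)]
  refine lintegral_mono fun X => add_le_add ?_ ?_
  · rw [kineticDensity_eq_realKinetic_add (Φ.contDiff.differentiable one_ne_zero) X]
    exact le_self_add
  · refine mul_le_mul' (interaction_mono h X) ?_
    rw [coe_nnnorm_sq_complex_eq_add (Φ.ψ X), ← enorm_eq_nnnorm]
    exact le_self_add

/-- The same in `ℝ`: if `⟨Φ, H(v) Φ⟩ ≤ E + δ` with `E, δ < ⊤`, then
`(∫|∇ Re Φ|²).toReal + (∫ W (Re Φ)²).toReal ≤ E.toReal + δ.toReal`. [folklore] -/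
theorem toReal_re_add_le {v w : ℝ → ℝ≥0∞} (h : ∀ r, w r ≤ v r) {L : ℝ} (Φ : TrialState N L)
    {E δ : ℝ≥0∞} (hE : E ≠ ⊤) (hδ : δ ≠ ⊤) (hΦ : energy v Φ ≤ E + δ) :
    (∫⁻ X, realKinetic (fun Y => (Φ.ψ Y).re) X).toReal +
        (∫⁻ X, interaction w X * ‖(Φ.ψ X).re‖ₑ ^ 2).toReal ≤ E.toReal + δ.toReal := by
  have hle := (lintegral_re_add_le_energy h Φ).trans hΦ
  have htop : E + δ ≠ ⊤ := ENNReal.add_ne_top.2 ⟨hE, hδ⟩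
  have h1 : (∫⁻ X, realKinetic (fun Y => (Φ.ψ Y).re) X) ≠ ⊤ :=
    ne_top_of_le_ne_top htop (le_self_add.trans hle)
  have h2 : (∫⁻ X, interaction w X * ‖(Φ.ψ X).re‖ₑ ^ 2) ≠ ⊤ :=
    ne_top_of_le_ne_top htop (le_add_self.trans hle)
  rw [← ENNReal.toReal_add h1 h2, ← ENNReal.toReal_add hE hδ]
  exact ENNReal.toReal_mono htop hle

/-- `|Re Φ − Ψ₀|² ≤ |Φ − Ψ₀|²` pointwise for a REAL `Ψ₀` (in `[0, ∞]`). [folklore] -/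
theorem enorm_re_sub_sq_le (z : ℂ) (r : ℝ) :
    ‖z.re - r‖ₑ ^ 2 ≤ ((‖z - (r : ℂ)‖₊ : ℝ≥0∞)) ^ 2 := by
  have h : z.re - r = (z - (r : ℂ)).re := by
    simp only [Complex.sub_re, Complex.ofReal_re]
  rw [h, enorm_eq_nnnorm, coe_nnnorm_sq_complex_eq_add (z - (r : ℂ))]
  exact le_self_add

/-! ### `L²(Λ)` bookkeeping -/

/-- `‖[g]‖² = ∫_Λ g²` for the `L²(Λ)` class `[g]` of a real `g`. [folklore] -/
theorem norm_toLp_sq {L : ℝ} {g : Config N → ℝ} (hg : MemLp g 2 (volume.restrict (boxN N L))) :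
    ‖hg.toLp g‖ ^ 2 = ∫ X in boxN N L, g X ^ 2 := by
  rw [← real_inner_self_eq_norm_sq, L2.inner_def]
  refine integral_congr_ae ?_
  filter_upwards [hg.coeFn_toLp] with X hX
  rw [RCLike.inner_apply, conj_trivial, hX, sq]

/-- `⟪[g], e^{-tH}[g]⟫ = ∫_Λ g · e^{-tH} g` for the `L²(Λ)` class `[g]` of a real `g` (`t > 0`;
`fkL2` acts by `fkReal`, which does not see null modifications on the box). [folklore] -/
theorem inner_toLp_fkL2_toLp {w : ℝ → ℝ≥0∞} (hw : Measurable w) (L : ℝ) {t : ℝ} (ht : 0 < t)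
    {g : Config N → ℝ} (hg : MemLp g 2 (volume.restrict (boxN N L))) :
    ⟪hg.toLp g, fkL2 w L t (hg.toLp g)⟫_ℝ = ∫ X in boxN N L, g X * fkReal w L t g X := by
  rw [L2.inner_def]
  refine integral_congr_ae ?_
  filter_upwards [hg.coeFn_toLp, fkL2_coeFn hw L ht (hg.toLp g)] with X h1 h2
  rw [RCLike.inner_apply, conj_trivial, h2, h1, fkReal_congr_ae_restrict w L ht hg.coeFn_toLp X,
    mul_comm]

/-- **`L²(Λ)`-convergence of classes** from `∫ |fₖ − g|² → 0` over the whole space. [folklore] -/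
theorem tendsto_toLp_of_lintegral {L : ℝ} {f : ℕ → Config N → ℝ} {g : Config N → ℝ}
    (hf : ∀ k, MemLp (f k) 2 (volume.restrict (boxN N L)))
    (hg : MemLp g 2 (volume.restrict (boxN N L)))
    (h : Tendsto (fun k => ∫⁻ X, ‖f k X - g X‖ₑ ^ 2) atTop (𝓝 0)) :
    Tendsto (fun k => (hf k).toLp (f k)) atTop (𝓝 (hg.toLp g)) := by
  rw [tendsto_iff_edist_tendsto_0]
  have hb : ∀ k, edist ((hf k).toLp (f k)) (hg.toLp g) ≤
      (∫⁻ X, ‖f k X - g X‖ₑ ^ 2) ^ (1 / 2 : ℝ) := fun k => by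
    rw [Lp.edist_toLp_toLp]
    refine (eLpNorm_restrict_le _ _ _ _).trans_eq ?_
    rw [eLpNorm_eq_lintegral_rpow_enorm_toReal two_ne_zero ENNReal.ofNat_ne_top,
      ENNReal.toReal_ofNat]
    simp_rw [ENNReal.rpow_two, Pi.sub_apply]
  have h' : Tendsto (fun k => (∫⁻ X, ‖f k X - g X‖ₑ ^ 2) ^ (1 / 2 : ℝ)) atTop
      (𝓝 ((0 : ℝ≥0∞) ^ (1 / 2 : ℝ))) :=
    (ENNReal.continuous_rpow_const.tendsto 0).comp h
  rw [ENNReal.zero_rpow_of_pos (by norm_num)] at h'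
  exact tendsto_of_tendsto_of_tendsto_of_le_of_le tendsto_const_nhds h' (fun _ => zero_le) hb

end ClosedJensen

/-! ### The stub -/

open ClosedJensen in
/-- **Stub `stub_closedJensen` of line `Sketch` — closed-form Jensen inequality against a dominated
bounded potential.** For `N ≥ 1`, `L > 0`, measurable `w ≤ v` with `w ≤ C`, and a nonnegative
closed-form ground state `Ψ₀` of `v`: `e^{-E₀(v)} ≤ ∫_Λ Ψ₀ · e^{-H(w)} Ψ₀`. Trial states `Φₖ → Ψ₀`
in `L²` with `v`-energies `≤ E₀(v) + 1/(k+1)` (`exists_trialState_near`) have real parts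
`fₖ = Re Φₖ` with `𝓔_w(fₖ) ≤ ⟨Φₖ, H(v) Φₖ⟩` and `‖fₖ − Ψ₀‖₂ → 0`; the landed `stub_fkJensen` for
`w` gives `‖fₖ‖² e^{-(E₀ + 1/(k+1))/‖fₖ‖²} ≤ ‖fₖ‖² e^{-𝓔_w(fₖ)/‖fₖ‖²} ≤ ∫_Λ fₖ · e^{-H(w)} fₖ`, and
`k → ∞`: `‖fₖ‖² → 1`, while the right side is the continuous quadratic form `⟪[f], T[f]⟫` of the
bounded operator `T = fkL2 w L 1` on `L²(Λ)` evaluated along `[fₖ] → [Ψ₀]`.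
[cite: ChungZhao1995, Prop 3.29] -/
theorem stub_closedJensen :
    ∀ (N : ℕ) (v w : ℝ → ℝ≥0∞) (C : ℝ≥0) (L : ℝ), 1 ≤ N → 0 < L → Measurable v → Measurable w →
      (∀ r, w r ≤ C) → (∀ r, w r ≤ v r) →
      ∀ Ψ₀ : Config N → ℝ, (∀ X, 0 ≤ Ψ₀ X) → IsGroundState v L (fun X => (Ψ₀ X : ℂ)) →
        Real.exp (-(groundStateEnergy v N L).toReal) ≤
          ∫ X in boxN N L, Ψ₀ X * fkReal w L 1 Ψ₀ X := by
  intro N v w C L _hN hL _hv hw hC hwv Ψ₀ _hΨ₀ hΨ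
  -- the ground-state energy is finite
  have hE : groundStateEnergy v N L ≠ ⊤ := hΨ.groundStateEnergy_ne_top
  -- tolerances `1/(k+1)`
  have hε_pos : ∀ k : ℕ, (0 : ℝ) < 1 / ((k : ℝ) + 1) := fun k => by positivity
  have hε_lim : Tendsto (fun k : ℕ => (1 : ℝ) / ((k : ℝ) + 1)) atTop (𝓝 0) :=
    tendsto_one_div_add_atTop_nhds_zero_nat
  have htol_pos : ∀ k : ℕ, (0 : ℝ≥0∞) < ENNReal.ofReal (1 / ((k : ℝ) + 1)) := fun k =>
    ENNReal.ofReal_pos.2 (hε_pos k)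
  have htol_lim : Tendsto (fun k : ℕ => ENNReal.ofReal (1 / ((k : ℝ) + 1))) atTop (𝓝 0) := by
    have h := ENNReal.tendsto_ofReal hε_lim
    rwa [ENNReal.ofReal_zero] at h
  -- near-minimising trial states close to `Ψ₀`
  have hstep : ∀ k : ℕ, ∃ T : TrialState N L,
      energy v T ≤ groundStateEnergy v N L + ENNReal.ofReal (1 / ((k : ℝ) + 1)) ∧
        ∫⁻ X, (‖T.ψ X - (Ψ₀ X : ℂ)‖₊ : ℝ≥0∞) ^ 2 ≤ ENNReal.ofReal (1 / ((k : ℝ) + 1)) :=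
    fun k => exists_trialState_near hΨ (htol_pos k) (htol_pos k)
  choose Φ hΦE hΦL2 using hstep
  -- their real parts: real `C¹` Dirichlet functions
  set f : ℕ → Config N → ℝ := fun k Y => ((Φ k).ψ Y).re with hfdef
  have hf1 : ∀ k, ContDiff ℝ 1 (f k) := fun k => Complex.reCLM.contDiff.comp (Φ k).contDiff
  have hf0 : ∀ k X, X ∉ boxN N L → f k X = 0 := fun k X hX => by
    simp only [hfdef, (Φ k).eq_zero X hX, Complex.zero_re]
  have hsupp : ∀ k, HasCompactSupport (f k) := fun k =>
    HasCompactSupport.intro' (isBounded_boxN N L).isCompact_closure isClosed_closure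
      fun x hx => hf0 k x fun h => hx (subset_closure h)
  have hfmem : ∀ k, MemLp (f k) 2 (volume.restrict (boxN N L)) := fun k =>
    ((hf1 k).continuous.memLp_of_hasCompactSupport (hsupp k)).restrict _
  -- the energies of the real parts against `w`
  have hq : ∀ k, (∫⁻ X, realKinetic (f k) X).toReal +
      (∫⁻ X, interaction w X * ‖f k X‖ₑ ^ 2).toReal ≤
        (groundStateEnergy v N L).toReal + 1 / ((k : ℝ) + 1) := fun k => by
    rw [← ENNReal.toReal_ofReal (hε_pos k).le]
    exact toReal_re_add_le hwv (Φ k) hE ENNReal.ofReal_ne_top (hΦE k)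
  -- `Ψ₀`: measurable, vanishing off the box, normalised, in `L²(Λ)`
  have hΨm : Measurable Ψ₀ := by
    have h := Complex.measurable_re.comp hΨ.measurable
    have heq : (Complex.re ∘ fun X => (Ψ₀ X : ℂ)) = Ψ₀ := funext fun X => Complex.ofReal_re _
    rwa [heq] at h
  have hΨz : ∀ X, X ∉ boxN N L → Ψ₀ X = 0 := fun X hX =>
    Complex.ofReal_eq_zero.1 (hΨ.eq_zero X hX)
  have hΨ1 : ∫⁻ X, ‖Ψ₀ X‖ₑ ^ 2 = 1 := by
    refine Eq.trans (lintegral_congr fun X => ?_) hΨ.norm_eq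
    rw [enorm_eq_nnnorm, Complex.nnnorm_real]
  have hΨsq : ∫ X, Ψ₀ X ^ 2 = 1 := by
    rw [integral_eq_lintegral_of_nonneg_ae (Eventually.of_forall fun X => sq_nonneg _)
      (hΨm.pow_const 2).aestronglyMeasurable]
    simp_rw [← enorm_sq_eq_ofReal_sq]
    rw [hΨ1, ENNReal.toReal_one]
  have hΨmem : MemLp Ψ₀ 2 (volume.restrict (boxN N L)) := by
    refine MemLp.restrict _ ⟨hΨm.aestronglyMeasurable, ?_⟩
    rw [eLpNorm_eq_lintegral_rpow_enorm_toReal two_ne_zero ENNReal.ofNat_ne_top,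
      ENNReal.toReal_ofNat]
    simp_rw [ENNReal.rpow_two]
    rw [hΨ1, ENNReal.one_rpow]
    exact ENNReal.one_lt_top
  -- `fₖ → Ψ₀` in `L²`, hence as classes in `L²(Λ)`
  have hL2 : Tendsto (fun k => ∫⁻ X, ‖f k X - Ψ₀ X‖ₑ ^ 2) atTop (𝓝 0) :=
    tendsto_of_tendsto_of_tendsto_of_le_of_le tendsto_const_nhds htol_lim (fun _ => zero_le)
      fun k => (lintegral_mono fun X => enorm_re_sub_sq_le ((Φ k).ψ X) (Ψ₀ X)).trans (hΦL2 k)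
  have hconv : Tendsto (fun k => (hfmem k).toLp (f k)) atTop (𝓝 (hΨmem.toLp Ψ₀)) :=
    tendsto_toLp_of_lintegral hfmem hΨmem hL2
  -- the squared norms `aₖ = ∫ fₖ² → 1`
  have ha_eq : ∀ k, ‖(hfmem k).toLp (f k)‖ ^ 2 = ∫ X, f k X ^ 2 := fun k => by
    rw [norm_toLp_sq, setIntegral_eq_integral_of_forall_compl_eq_zero]
    exact fun X hX => by simp [hf0 k X hX]
  have hΨL1 : ‖hΨmem.toLp Ψ₀‖ ^ 2 = 1 := by
    rw [norm_toLp_sq, setIntegral_eq_integral_of_forall_compl_eq_zero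
      (fun X hX => by simp [hΨz X hX]), hΨsq]
  have ha : Tendsto (fun k => ∫ X, f k X ^ 2) atTop (𝓝 1) := by
    have h := hconv.norm.pow 2
    rw [hΨL1] at h
    exact h.congr fun k => ha_eq k
  -- the pairings `∫_Λ fₖ · T fₖ → ∫_Λ Ψ₀ · T Ψ₀`
  have hP : Tendsto (fun k => ∫ X in boxN N L, f k X * fkReal w L 1 (f k) X) atTop
      (𝓝 (∫ X in boxN N L, Ψ₀ X * fkReal w L 1 Ψ₀ X)) := by
    have hT : Tendsto (fun k => fkL2 w L 1 ((hfmem k).toLp (f k))) atTop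
        (𝓝 (fkL2 w L 1 (hΨmem.toLp Ψ₀))) :=
      ((fkL2 w L 1).continuous.tendsto _).comp hconv
    have h := Filter.Tendsto.inner (𝕜 := ℝ) hconv hT
    rw [inner_toLp_fkL2_toLp hw L one_pos hΨmem] at h
    exact h.congr fun k => inner_toLp_fkL2_toLp hw L one_pos (hfmem k)
  -- Jensen on the core, with the energy bound inserted
  have hJ : ∀ k, (∫ X, f k X ^ 2) *
      Real.exp (-(((groundStateEnergy v N L).toReal + 1 / ((k : ℝ) + 1)) / ∫ X, f k X ^ 2)) ≤
        ∫ X in boxN N L, f k X * fkReal w L 1 (f k) X := fun k => by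
    refine le_trans ?_ (stub_fkJensen N w C L hw hC hL (f k) (hf1 k) (hf0 k))
    have ha0 : 0 ≤ ∫ X, f k X ^ 2 := integral_nonneg fun X => sq_nonneg _
    exact mul_le_mul_of_nonneg_left (Real.exp_le_exp.2 (neg_le_neg
      (div_le_div_of_nonneg_right (hq k) ha0))) ha0
  -- the Jensen lower bounds tend to `e^{-E₀}`
  have hlow : Tendsto (fun k => (∫ X, f k X ^ 2) *
      Real.exp (-(((groundStateEnergy v N L).toReal + 1 / ((k : ℝ) + 1)) / ∫ X, f k X ^ 2)))
      atTop (𝓝 (Real.exp (-(groundStateEnergy v N L).toReal))) := by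
    have h1 : Tendsto (fun k : ℕ => ((groundStateEnergy v N L).toReal + 1 / ((k : ℝ) + 1)) /
        ∫ X, f k X ^ 2) atTop (𝓝 (groundStateEnergy v N L).toReal) := by
      have h := ((tendsto_const_nhds (x := (groundStateEnergy v N L).toReal)).add hε_lim).div
        ha one_ne_zero
      rwa [add_zero, div_one] at h
    have h2 := ha.mul ((Real.continuous_exp.tendsto _).comp h1.neg)
    rw [one_mul] at h2
    exact h2
  exact le_of_tendsto_of_tendsto' hlow hP hJ

end Summit.AtomisticToContinuum.BoseEinsteinCondensation.Theorems.GroundStateRigidity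

end
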